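import Summits.BirchSwinnertonDyer.Rank1Residual.GaloisImage.KolyvaginCongruenceRatBot
import Summits.BirchSwinnertonDyer.Rank1Residual.GaloisImage.TransverseLocalCriterion
import Literature.NumberTheory.GaloisRepresentations.ModPCyclotomicCharacterInertiaSurjective
import HarnessLib

/-!
# Local plumbing at a Kolyvagin prime `q` of `ℚ` for THEOREM D-tr (restriction along
# `Γ_{ℚ_q} → Γ_ℚ`, the marked Frobenius powers, the `(X−1)²`-shape of the Euler factors) — file 4c
# of row T-DER-TR (cell `b2b-bsdres`, team n1011, seat p15 GEN 8, OWNERS row T-DER-TR =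
# skel/T-DER-TR.md)

HONEST FRAMING (cell `b2b-bsdres`, run/shared/lean/b2b/bsd-rank1-residual/, verbatim in every
file): the goal of the cell is to DELETE the COMBINATION-SHAPED residual classes of the
Birch–Swinnerton-Dyer formula for ALL analytic-rank `≤ 1` elliptic curves over `ℚ` — "full BSD
formula for every rank `≤ 1` curve in class `C`" assembled STRICTLY from published theorems — so
that the rank-`≤ 1` remainder becomes exactly the CONSTRUCTION-SHAPED classes, which are TYPED
(missing-input `Prop`s), NOT attempted. This is not "finishing BSD". Team n1011: research route on
the CONSTRUCTION-SHAPED class X4 / §I N11 (route-1 PORT, (P-DER)); TOOL theorems (no definition,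
no named fact, no `sorry`).

## What (inputs of the END `Rat.exists_apply_eq_rho_sub_of_deriv` of file 4d, all over `ℚ`)

§1 Restriction `res : Γ_{ℚ_q} → Γ_ℚ` (tree `absGaloisRestrict`,
`modNCyclotomicCharacter_absGaloisRestrict`,
`modNCyclotomicCharacter_absGaloisRestrict_eq_one_of_mem_absInertia`, `rootsOfUnityFixer_eq_ker`):
an element of `Γ_{ℚ_q}` fixing `μ_q` restricts into the tame level `Gal(ℚ̄/ℚ(μ_q))`
(`absGaloisRestrict_mem_tameLevel`); an INERTIA element fixing `μ_q` restricts into every level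
`Gal(ℚ̄/ℚ(μ_n))` (`absGaloisRestrict_mem_level_of_mem_absInertia`: `q′ ∤ ℓ′` is unramified);
there is a local arithmetic Frobenius fixing `μ_q`
(`exists_isFrobPow_one_modPCyclotomicCharacterZMod_eq_one`, by `χ̄_q(I_{ℚ_q}) = 𝔽_qˣ`, tree
`Rat.exists_mem_absInertia_adicCompletion_modPCyclotomicCharacterZMod_eq`),
and it restricts to an arithmetic Frobenius at `𝔓₀ = adicCompletionPrime ℚ q`
(`isArithFrobAt_absGaloisRestrict_of_isFrobPow_one`).
§2 The marked set `𝒢_f = {φ^f : φ an arithmetic Frobenius at some 𝔔 ∣ q fixing μ_q}` is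
conjugation-invariant and lies in `Gal(ℚ̄/ℚ(μ_n))` for the exponent `f` of CK-1b
(`conj_mem_frobeniusPowSet`, `mem_level_of_mem_frobeniusPowSet`).
§3 Arithmetic at Kolyvagin primes of level `k` (`ℓ ≡ 1`, `a_ℓ ≡ ℓ + 1 (mod p^k)`): `p^k ∣ ℓ − 1`
in `ℤ_p` (`exists_natCast_sub_one_eq_pow_mul`), `Σ_{j<q−1} j` kills every `p^k`-torsion module for
`p` odd (`sum_range_natCast_smul_eq_zero`), and the `(X−1)²`-shapes of Rubin's Euler factor
`P_ℓ = (X−1)² + p^k R_ℓ` and of the modified factor `P_q − (q−1) E_q = (X−1)² + p^k R_q` on `T_pE`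
(`exists_rubinEulerFactor_eq_sq_add`, `exists_rubinEulerFactor_sub_eq_sq_add`; K1
`rubinEulerFactor_galoisRepTate` BY NAME).

References: B. Mazur, K. Rubin, *Kolyvagin systems*, Mem. AMS 799 (2004), App. A (p. 85: "Fix a
representative `Fr_ℓ` so that `Fr_ℓ = 1` on `ℚ(ℓ)`"); J.-P. Serre, *Local Fields*, IV §4;
K. Rubin, *Euler Systems* (2000), §4.5.
-/

noncomputable section

open CategoryTheory Function Finset Polynomial Field IsDedekindDomain NumberField
open scoped NumberField Pointwise
open Literature.NumberTheory Literature.NumberTheory.GaloisRepresentations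
open Literature.NumberTheory.EllipticCurves
open Literature.NumberTheory.GaloisRepresentations.IsNonarchimedeanLocalField
open Summit.BirchSwinnertonDyer.Rank1Residual.GaloisImage.CyclotomicLevel
open Rat.HeightOneSpectrum

universe u

namespace Summit.BirchSwinnertonDyer.Rank1Residual.GaloisImage

namespace Derivative

namespace Transverse

namespace Rat

variable {p : ℕ} [hp : Fact p.Prime] (S : Set (HeightOneSpectrum (𝓞 ℚ)))

/-! ### §1 Restriction along `Γ_{ℚ_q} → Γ_ℚ` -/

/-- **An element of `Γ_{ℚ_q}` fixing `μ_q` restricts into `Gal(ℚ̄/ℚ(μ_q))`** (the tame level at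
`q` of `cyclotomicLevelsRat p S`): `χ̄_q(res g) = χ̄_q(g)`. [folklore] -/
theorem absGaloisRestrict_mem_tameLevel (q : HeightOneSpectrum (𝓞 ℚ))
    [Fact (Nat.Prime ((primesEquiv q : Nat.Primes) : ℕ))]
    [NeZero ((((primesEquiv q : Nat.Primes) : ℕ) : ℕ) : q.adicCompletion ℚ)]
    {g : absoluteGaloisGroup (q.adicCompletion ℚ)}
    (hg : modPCyclotomicCharacterZMod (q.adicCompletion ℚ) ((primesEquiv q : Nat.Primes) : ℕ) g =
      1) :
    absGaloisRestrict ℚ (q.adicCompletion ℚ) g ∈ (cyclotomicLevelsRat p S).tameLevel q := by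
  haveI : NeZero ((primesEquiv q : Nat.Primes) : ℕ) := ⟨(primesEquiv q).2.ne_zero⟩
  rw [CyclotomicLevel.Rat.cyclotomicLevelsRat_tameLevel, rootsOfUnityFixer_eq_ker,
    MonoidHom.mem_ker, modNCyclotomicCharacter_absGaloisRestrict ℚ (q.adicCompletion ℚ),
    ← modPCyclotomicCharacterZMod_eq_modNCyclotomicCharacter]
  exact hg

/-- **An inertia element of `Γ_{ℚ_q}` fixing `μ_q` restricts into every level
`Gal(ℚ̄/ℚ(μ_t))`** (`t` any finite set of places): at `ℓ ≠ q` inertia at `q` fixes `μ_ℓ`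
(`q ∤ ℓ` unramified in `ℚ(μ_ℓ)`), at `ℓ = q` by hypothesis. [folklore] -/
theorem absGaloisRestrict_mem_level_of_mem_absInertia (q : HeightOneSpectrum (𝓞 ℚ))
    [Fact (Nat.Prime ((primesEquiv q : Nat.Primes) : ℕ))]
    [NeZero ((((primesEquiv q : Nat.Primes) : ℕ) : ℕ) : q.adicCompletion ℚ)]
    (t : Finset (HeightOneSpectrum (𝓞 ℚ)))
    {τ : absoluteGaloisGroup (q.adicCompletion ℚ)} (hτ : τ ∈ absInertia (q.adicCompletion ℚ))
    (hτq : modPCyclotomicCharacterZMod (q.adicCompletion ℚ) ((primesEquiv q : Nat.Primes) : ℕ) τ =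
      1) :
    absGaloisRestrict ℚ (q.adicCompletion ℚ) τ ∈ (cyclotomicLevelsRat p S).level ⊥ t := by
  haveI : CharZero (q.adicCompletion ℚ) :=
    charZero_of_injective_algebraMap (algebraMap ℚ (q.adicCompletion ℚ)).injective
  refine mem_level_of_forall (cyclotomicLevelsRat p S)
    (by rw [(cyclotomicLevelsRat p S).pLevel_bot]; exact Subgroup.mem_top _) fun ℓ hℓ => ?_
  by_cases hℓq : ℓ = q
  · subst hℓq
    exact absGaloisRestrict_mem_tameLevel S ℓ hτq
  · haveI : NeZero ((primesEquiv ℓ : Nat.Primes) : ℕ) := ⟨(primesEquiv ℓ).2.ne_zero⟩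
    have hne : ¬ ((primesEquiv q : Nat.Primes) : ℕ) ∣ ((primesEquiv ℓ : Nat.Primes) : ℕ) := fun h =>
      hℓq (primesEquiv.injective (Subtype.ext
        ((Nat.prime_dvd_prime_iff_eq (primesEquiv q).2 (primesEquiv ℓ).2).mp h).symm))
    rw [CyclotomicLevel.Rat.cyclotomicLevelsRat_tameLevel, rootsOfUnityFixer_eq_ker,
      MonoidHom.mem_ker]
    exact modNCyclotomicCharacter_absGaloisRestrict_eq_one_of_mem_absInertia _ q hne hτ

/-- **A local arithmetic Frobenius of `ℚ_q` fixing `μ_q` exists**: multiply any arithmetic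
Frobenius `φ₀` by an inertia element `σ` with `χ̄_q(σ) = χ̄_q(φ₀)⁻¹` (`χ̄_q(I_{ℚ_q}) = 𝔽_qˣ`,
Serre *Local Fields* IV §4 Prop. 17–18). [folklore] -/
theorem exists_isFrobPow_one_modPCyclotomicCharacterZMod_eq_one (q : HeightOneSpectrum (𝓞 ℚ))
    [Fact (Nat.Prime ((primesEquiv q : Nat.Primes) : ℕ))]
    [NeZero ((((primesEquiv q : Nat.Primes) : ℕ) : ℕ) : q.adicCompletion ℚ)] :
    ∃ φ₁ : absoluteGaloisGroup (q.adicCompletion ℚ), IsFrobPow φ₁ 1 ∧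
      modPCyclotomicCharacterZMod (q.adicCompletion ℚ) ((primesEquiv q : Nat.Primes) : ℕ) φ₁ =
        1 := by
  obtain ⟨φ₀, hφ₀⟩ := exists_isAbsArithFrob_holds (q.adicCompletion ℚ)
  obtain ⟨σ, hσI, hσ⟩ :=
    GaloisRepresentations.Rat.exists_mem_absInertia_adicCompletion_modPCyclotomicCharacterZMod_eq
      q rfl
      (modPCyclotomicCharacterZMod (q.adicCompletion ℚ) ((primesEquiv q : Nat.Primes) : ℕ) φ₀)⁻¹
  refine ⟨σ * φ₀, IsFrobPow.inertia_mul_holds hσI (IsAbsArithFrob.isFrobPow_holds hφ₀), ?_⟩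
  rw [map_mul, hσ, inv_mul_cancel]

/-- **A local arithmetic Frobenius restricts to an arithmetic Frobenius at
`𝔓₀ = adicCompletionPrime ℚ q`** (tree `isArithFrobAt_absGaloisRestrict_adicCompletionPrime_iff`).
[folklore] -/
theorem isArithFrobAt_absGaloisRestrict_of_isFrobPow_one (q : HeightOneSpectrum (𝓞 ℚ))
    {φ₁ : absoluteGaloisGroup (q.adicCompletion ℚ)} (hφ₁ : IsFrobPow φ₁ 1) :
    IsArithFrobAt (𝓞 ℚ) (absGaloisRestrict ℚ (q.adicCompletion ℚ) φ₁) (adicCompletionPrime ℚ q) :=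
  (isArithFrobAt_absGaloisRestrict_adicCompletionPrime_iff ℚ q
    (by rw [Literature.NumberTheory.Automorphic.residueFieldCard_adicCompletion_eq ℚ q,
      HeightOneSpectrum.residueCard_eq_card_quotient]) φ₁).2
    (isFrobPow_one_iff_isAbsArithFrob_holds.mp hφ₁)

/-! ### §2 The marked Frobenius powers `𝒢_f` -/

/-- **`𝒢_f` is conjugation-invariant**: `h⁻¹ φ^f h = (h⁻¹ φ h)^f`, and `h⁻¹ φ h` is an arithmetic
Frobenius at `h⁻¹ • 𝔔 ∣ q` fixing `μ_q` (`Gal(ℚ̄/ℚ(μ_q))` is normal). [folklore] -/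
theorem conj_mem_frobeniusPowSet (q : HeightOneSpectrum (𝓞 ℚ)) (f : ℕ)
    {g : absoluteGaloisGroup ℚ}
    (hg : g ∈ {g : absoluteGaloisGroup ℚ | ∃ 𝔔 ∈ q.primesAbove, ∃ φ : absoluteGaloisGroup ℚ,
      IsArithFrobAt (𝓞 ℚ) φ 𝔔 ∧ φ ∈ (cyclotomicLevelsRat p S).tameLevel q ∧ g = φ ^ f})
    (h : absoluteGaloisGroup ℚ) :
    h⁻¹ * g * h ∈ {g : absoluteGaloisGroup ℚ | ∃ 𝔔 ∈ q.primesAbove, ∃ φ : absoluteGaloisGroup ℚ,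
      IsArithFrobAt (𝓞 ℚ) φ 𝔔 ∧ φ ∈ (cyclotomicLevelsRat p S).tameLevel q ∧ g = φ ^ f} := by
  haveI hN : ((cyclotomicLevelsRat p S).tameLevel q).Normal :=
    Subgroup.Normal.of_commutator_le _ ((cyclotomicLevelsRat p S).commutator_le_tameLevel q)
  obtain ⟨𝔔, h𝔔, φ, hφ, hφq, rfl⟩ := hg
  refine ⟨h⁻¹ • 𝔔, smul_mem_primesAbove h𝔔 h⁻¹, h⁻¹ * φ * h, ?_, hN.conj_mem' φ hφq h, ?_⟩
  · have hc := hφ.conj h⁻¹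
    rwa [inv_inv] at hc
  · have hc := conj_pow (a := h⁻¹) (b := φ) (i := f)
    rw [inv_inv] at hc
    exact hc.symm

/-- **`𝒢_f ⊆ Gal(ℚ̄/ℚ(μ_t))`** for the CK-1b exponent `f` (`q′^f ≡ 1 (mod ℓ′)` for `ℓ ∈ t`,
`ℓ ≠ q`): tree `CyclotomicLevel.Rat.frobenius_pow_mem_level`. [folklore] -/
theorem mem_level_of_mem_frobeniusPowSet {q : HeightOneSpectrum (𝓞 ℚ)}
    (hq : q ∈ (cyclotomicLevelsRat p S).primes) (t : Finset (HeightOneSpectrum (𝓞 ℚ))) {f : ℕ}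
    (hft : ∀ ℓ ∈ t, ℓ ≠ q →
      ((primesEquiv q : Nat.Primes) : ℕ) ^ f ≡ 1 [MOD ((primesEquiv ℓ : Nat.Primes) : ℕ)])
    {g : absoluteGaloisGroup ℚ}
    (hg : g ∈ {g : absoluteGaloisGroup ℚ | ∃ 𝔔 ∈ q.primesAbove, ∃ φ : absoluteGaloisGroup ℚ,
      IsArithFrobAt (𝓞 ℚ) φ 𝔔 ∧ φ ∈ (cyclotomicLevelsRat p S).tameLevel q ∧ g = φ ^ f}) :
    g ∈ (cyclotomicLevelsRat p S).level ⊥ t := by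
  obtain ⟨𝔔, h𝔔, φ, hφ, hφq, rfl⟩ := hg
  exact CyclotomicLevel.Rat.frobenius_pow_mem_level hq ⟨𝔔, h𝔔, hφ⟩ hφq t hft
    (by rw [Nat.bot_eq_zero, pow_zero]; exact Nat.modEq_one)

/-! ### §3 Arithmetic at Kolyvagin primes of level `k` -/

/-- `p^k ∣ ℓ − 1` in `ℤ_p` for `ℓ ≡ 1 (mod p^k)`. [folklore] -/
theorem exists_natCast_sub_one_eq_pow_mul {k ℓ : ℕ} (hℓ : ℓ ≡ 1 [MOD p ^ k]) :
    ∃ b : ℤ_[p], ((ℓ - 1 : ℕ) : ℤ_[p]) = (p : ℤ_[p]) ^ k * b := by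
  rcases Nat.eq_zero_or_pos ℓ with rfl | hℓ0
  · exact ⟨0, by simp⟩
  · obtain ⟨b, hb⟩ := (Nat.modEq_iff_dvd' hℓ0).mp hℓ.symm
    exact ⟨b, by rw [hb, Nat.cast_mul, Nat.cast_pow]⟩

/-- **`Σ_{j < ℓ−1} j` kills a `p^k`-torsion `ℤ_p`-module** for `p` odd and `ℓ ≡ 1 (mod p^k)`:
`2 Σ_{j<ℓ−1} j = (ℓ−1)(ℓ−2)` and `p^k ∣ ℓ − 1`, `p ∤ 2`. (The `hodd` input of file 3b:
`D_q x = Σ j σ_q^j x = (Σ j) x` for a `σ_q`-invariant `x`.) [folklore] -/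
theorem sum_range_natCast_smul_eq_zero (hp2 : p ≠ 2) {k ℓ : ℕ} (hℓ : ℓ ≡ 1 [MOD p ^ k])
    {M' : Type*} [AddCommGroup M'] [Module ℤ_[p] M'] (hM : ∀ m : M', ((p : ℤ_[p]) ^ k) • m = 0)
    (v : M') : ((∑ j ∈ range (ℓ - 1), j : ℕ) : ℤ_[p]) • v = 0 := by
  have hcop : Nat.Coprime (p ^ k) 2 :=
    Nat.Coprime.pow_left k ((Nat.coprime_primes hp.out Nat.prime_two).mpr hp2)
  have hdvd : p ^ k ∣ ℓ - 1 := by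
    rcases Nat.eq_zero_or_pos ℓ with rfl | hℓ0
    · simp
    · exact (Nat.modEq_iff_dvd' hℓ0).mp hℓ.symm
  have h2 : p ^ k ∣ (∑ j ∈ range (ℓ - 1), j) * 2 := by
    rw [Finset.sum_range_id_mul_two]
    exact dvd_mul_of_dvd_left hdvd _
  obtain ⟨m, hm⟩ := hcop.dvd_of_dvd_mul_right h2
  rw [hm, Nat.cast_mul, Nat.cast_pow, mul_comm, mul_smul, hM, smul_zero]

variable (W : WeierstrassCurve ℚ) [W.IsElliptic] [W.IsGloballyMinimal]
variable [Module.Free ℤ_[p] (W.tateModule p)] [Module.Finite ℤ_[p] (W.tateModule p)]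

/-- **`P_ℓ(X) = (X − 1)² + p^k R_ℓ(X)` on `T_pE` at a Kolyvagin prime of level `k`**
(`P_ℓ = 1 − ℓ⁻¹ a_ℓ X + ℓ⁻¹ X²`, K1 `rubinEulerFactor_galoisRepTate`; `ℓ ≡ 1`,
`a_ℓ ≡ ℓ + 1 (mod p^k)`).
The `hPℓ` input of file 3b. [cite: MazurRubin2004, App. A, (33) and Lemma A.12 (pp. 80, 86)] -/
theorem exists_rubinEulerFactor_eq_sq_add {k : ℕ} {ℓ : HeightOneSpectrum (𝓞 ℚ)}
    (hKol : Kato.IsKolyvaginPrime W p k ((primesEquiv ℓ : Nat.Primes) : ℕ))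
    {Fr : absoluteGaloisGroup ℚ} (hFr : IsArithFrobAtPlace ℚ ℓ Fr) :
    ∃ R : ℤ_[p][X], rubinEulerFactor (W.galoisRepTate p) (cyclotomicCharacterToUnits ℚ p ℤ_[p]) Fr =
      (Polynomial.X - C 1) ^ 2 + C ((p : ℤ_[p]) ^ k) * R := by
  obtain ⟨u, hu, hP⟩ := CyclotomicLevel.Rat.rubinEulerFactor_galoisRepTate W p hKol.ne
    (CyclotomicLevel.Rat.hasGoodReductionAt_of_isKolyvaginPrime W hKol) hFr
  obtain ⟨b, hb⟩ := exists_natCast_sub_one_eq_pow_mul (p := p) hKol.modEq_one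
  obtain ⟨b', hb'⟩ := (Int.modEq_iff_dvd.mp hKol.frobeniusTrace_modEq.symm)
  -- `hb' : (a_ℓ : ℤ) - (ℓ + 1) = p^k * b'`
  set ℓ' : ℕ := ((primesEquiv ℓ : Nat.Primes) : ℕ) with hℓ'
  have h1 : 1 ≤ ℓ' := (primesEquiv ℓ).2.one_lt.le
  have hu' : (u : ℤ_[p]) = 1 + (p : ℤ_[p]) ^ k * b := by
    rw [hu, ← hb]
    have : ((ℓ' : ℕ) : ℤ_[p]) = ((1 + (ℓ' - 1) : ℕ) : ℤ_[p]) := by rw [Nat.add_sub_cancel' h1]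
    rw [this, Nat.cast_add, Nat.cast_one]
  have ha : (W.frobeniusTrace ℓ' : ℤ_[p]) = (u : ℤ_[p]) + 1 + (p : ℤ_[p]) ^ k * (b' : ℤ_[p]) := by
    have h := congrArg (fun z : ℤ => (z : ℤ_[p])) hb'
    push_cast at h
    rw [hu]
    linear_combination h
  have hinv : C (↑u⁻¹ : ℤ_[p]) * C (↑u : ℤ_[p]) = 1 := by rw [← C_mul, Units.inv_mul, C_1]
  have hu'' := congrArg C hu'
  have ha' := congrArg C ha
  simp only [C_add, C_mul, C_pow, C_1] at hu'' ha'
  refine ⟨C (↑u⁻¹ : ℤ_[p]) * (- C b * X ^ 2 - (C (b' : ℤ_[p]) - C b) * X), ?_⟩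
  rw [hP]
  simp only [C_mul, C_pow, C_1]
  linear_combination (X ^ 2 - 2 * X) * hinv + (C (↑u⁻¹ : ℤ_[p]) * (X - X ^ 2)) * hu'' +
    (- C (↑u⁻¹ : ℤ_[p]) * X) * ha'

/-- **`P_q(X) − (q − 1)·E_q(X) = (X − 1)² + p^k R_q(X)` on `T_pE`** with the auxiliary polynomial
`E_q = u⁻¹ (a_q X − (q+1) X²)`, `u = q ∈ ℤ_pˣ` (so `P_q − (q−1)E_q = 1 − a_q X + q X²`, the Euler
factor in Kato's normalisation, `≡ (X−1)²`).  The `hPq` input of file 3b.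
[cite: MazurRubin2004, App. A, (33) and Lemma A.12 (pp. 80, 86)] -/
theorem exists_rubinEulerFactor_sub_eq_sq_add {k : ℕ} {q : HeightOneSpectrum (𝓞 ℚ)}
    (hKol : Kato.IsKolyvaginPrime W p k ((primesEquiv q : Nat.Primes) : ℕ))
    {Fr : absoluteGaloisGroup ℚ} (hFr : IsArithFrobAtPlace ℚ q Fr)
    (u : ℤ_[p]ˣ) (hu : (u : ℤ_[p]) = ((primesEquiv q : Nat.Primes) : ℕ)) :
    ∃ R : ℤ_[p][X], rubinEulerFactor (W.galoisRepTate p) (cyclotomicCharacterToUnits ℚ p ℤ_[p]) Fr -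
        C ((((primesEquiv q : Nat.Primes) : ℕ) - 1 : ℕ) : ℤ_[p]) *
          (C (↑u⁻¹ : ℤ_[p]) * (C (W.frobeniusTrace (primesEquiv q) : ℤ_[p]) * X -
            C ((((primesEquiv q : Nat.Primes) : ℕ) : ℤ_[p]) + 1) * X ^ 2)) =
      (Polynomial.X - C 1) ^ 2 + C ((p : ℤ_[p]) ^ k) * R := by
  obtain ⟨u', hu', hP⟩ := CyclotomicLevel.Rat.rubinEulerFactor_galoisRepTate W p hKol.ne
    (CyclotomicLevel.Rat.hasGoodReductionAt_of_isKolyvaginPrime W hKol) hFr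
  have huu : u' = u := Units.ext (by rw [hu', hu])
  rw [huu] at hP
  clear hu' huu
  obtain ⟨b, hb⟩ := exists_natCast_sub_one_eq_pow_mul (p := p) hKol.modEq_one
  obtain ⟨b', hb'⟩ := (Int.modEq_iff_dvd.mp hKol.frobeniusTrace_modEq.symm)
  set q' : ℕ := ((primesEquiv q : Nat.Primes) : ℕ) with hq'
  have h1 : 1 ≤ q' := (primesEquiv q).2.one_lt.le
  have hq1 : ((q' : ℕ) : ℤ_[p]) = 1 + (p : ℤ_[p]) ^ k * b := by
    rw [← hb]
    have : ((q' : ℕ) : ℤ_[p]) = ((1 + (q' - 1) : ℕ) : ℤ_[p]) := by rw [Nat.add_sub_cancel' h1]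
    rw [this, Nat.cast_add, Nat.cast_one]
  have ha : (W.frobeniusTrace q' : ℤ_[p]) = (q' : ℤ_[p]) + 1 + (p : ℤ_[p]) ^ k * (b' : ℤ_[p]) := by
    have h := congrArg (fun z : ℤ => (z : ℤ_[p])) hb'
    push_cast at h
    linear_combination h
  have hinv : C (↑u⁻¹ : ℤ_[p]) * C ((q' : ℕ) : ℤ_[p]) = 1 := by
    rw [← hu, ← C_mul, Units.inv_mul, C_1]
  have hq1' := congrArg C hq1
  have ha' := congrArg C ha
  simp only [C_add, C_mul, C_pow, C_1] at hq1' ha'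
  refine ⟨C b * X ^ 2 - (C b + C (b' : ℤ_[p])) * X, ?_⟩
  rw [hP, hb]
  simp only [C_add, C_mul, C_pow, C_1]
  linear_combination (-(C ((q' : ℕ) : ℤ_[p]) + 1 + C (p : ℤ_[p]) ^ k * C (b' : ℤ_[p])) * X +
      C ((q' : ℕ) : ℤ_[p]) * X ^ 2) * hinv +
    ((C (↑u⁻¹ : ℤ_[p]) * C (W.frobeniusTrace q' : ℤ_[p]) - 1) * X +
      (1 - C (↑u⁻¹ : ℤ_[p]) * (C ((q' : ℕ) : ℤ_[p]) + 1)) * X ^ 2) * hq1' +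
    (- C (↑u⁻¹ : ℤ_[p]) * C ((q' : ℕ) : ℤ_[p]) * X) * ha'

end Rat

end Transverse

end Derivative

end Summit.BirchSwinnertonDyer.Rank1Residual.GaloisImage

end
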